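/-
Copyright (c) 2026 the pub-hodgecm-mathlib formalisation cell (harness21).  Prover seat hodgecm-mathlib-K2Liu-p10 (g2), Track B «K2-LIT»,
#184♮ = hLiu418 = `stmt-HodgeConjecture-24832`; ROAD Φ (RULING «M-156n»), organ G5 ∕ clause (ii) of every term package (K2E5-plan (g6) co-deal 08:16:30Z,
binding 08:19:27Z (4)); file 0 of G5-a.  THEOREMS ONLY (no `def`, no `instance`, no named-fact hypothesis, no `sorry`); Mathlib + ★ Vitali only.
-/
import Literature.Analysis.Complex.VitaliConvergence
import Mathlib.Analysis.Complex.Convex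
import Mathlib.Analysis.Convex.PathConnected
import HarnessLib

/-!
# Crux `HLiu418`, ROAD Φ: CONTINUITY OF A CONTINUATION IN THE GROUP VARIABLE PROPAGATES FROM THE CONVERGENCE HALF-PLANE
# (Vitali's theorem + the identity principle, the device of ★ `continuous_tateNumeratorGL` made abstract)

Cell `hodgecm-mathlib`, crux item hLiu418 = `stmt-HodgeConjecture-24832` (helper lane, count-neutral).  Every TERM PACKAGE `(P, E⋆)` of Road Φ
(★ `K2LiuContinuationPackageAlgebra`, ★ Φ9 `K2LiuSiegelEisensteinAssembly`) owes clause (ii): «`h ↦ E⋆(s, h)` is continuous for every `s` with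
`0 < re s`».  On the convergence half-plane this is the continuity of an absolutely convergent series ∕ integral; BELOW it, `E⋆(s, ·)` is only
defined by analytic continuation in `s`, pointwise in `h`.  This file proves, once and for all organs (Φ7-2∕7-3 via ★ Φ7c, Φ8 ∕ A7-reg local packages,
the A∞ organ), that continuity PROPAGATES:
* **`continuous_of_differentiableOn_of_locallyBounded`** — `X` a first-countable topological space, `U ⊆ ℂ` open and preconnected, `G : ℂ → X → ℂ` with
  (a) `s ↦ G s x` holomorphic on `U` for every `x`, (b) LOCAL BOUNDEDNESS on compacts: for every compact `K ⊆ X` and `a ∈ U` there are `M`, `r > 0` with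
  `‖G s x‖ ≤ M` for `s ∈ ball a r`, `x ∈ K` (this is clause (v) «growth `≤ C‖h‖^A` locally uniformly in `s`» read on a compact, where the height is
  bounded), (c) `x ↦ G s x` continuous for `s` in a set `W ⊆ U` containing a ball — THEN `x ↦ G s x` is continuous for EVERY `s ∈ U`.
  Proof: along a sequence `x_k → x₀` the entire functions `F_k := G · x_k` are locally bounded on `U` (the set `{x₀} ∪ {x_k}` is compact) and converge
  to `G · x₀` pointwise on the ball in `W`; by ★ Vitali (`Literature.Analysis.Complex.exists_tendstoLocallyUniformlyOn_of_frequently_tendsto`) they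
  converge locally uniformly on `U` to a holomorphic `f′`, which agrees with `G · x₀` on the ball, hence on `U` (identity principle); so
  `G s x_k → G s x₀` for every `s ∈ U` — sequential continuity, i.e. continuity (`X` first countable).
* `continuous_of_differentiableOn_halfPlane` — the half-plane form `U = {a < re}`, `W = {c < re}` (`a ≤ c`), which is how the organs use it.
Sources: [Titchmarsh1939, §5.21 (Vitali)]; [CogdellAnalyticTheory2004, §2.3 p. 211 («continuous … uniformly for g in compact sets»)];
[MoeglinWaldspurger1995, IV.1.9].
HONEST LABEL.  Helper lemmas, count-neutral; `HC_CM` is proved only modulo the 7 printed citations (2 remaining named inputs: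
hLiu418 = `stmt-HodgeConjecture-24832`, h413 = `stmt-HodgeConjecture-24833`) until rung 0 closes.
-/

set_option autoImplicit false
set_option linter.dupNamespace false -- the mandated namespace repeats `HodgeConjecture.HodgeConjecture`

noncomputable section

namespace Summit.HodgeConjecture.HodgeConjecture.Cruxes.HLiu418.K2LiuContinuityFromHalfPlane

open Set Filter Topology Metric Complex

variable {X : Type*} [TopologicalSpace X] [FirstCountableTopology X]

/-- **CONTINUITY IN THE PARAMETER PROPAGATES FROM AN OPEN SUBSET BY VITALI'S THEOREM.**  `U ⊆ ℂ` open preconnected; `G : ℂ → X → ℂ` holomorphic on `U`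
in `s` for each `x`, locally bounded on `U` uniformly on compacts of `X`, and continuous in `x` for all `s` in a ball `ball z₀ ρ ⊆ U`.  Then `G s` is
continuous for every `s ∈ U`. [cite: CogdellAnalyticTheory2004, §2.3 p. 211] [cite: MoeglinWaldspurger1995, IV.1.9] -/
theorem continuous_of_differentiableOn_of_locallyBounded {U : Set ℂ} (hU : IsOpen U) (hUc : IsPreconnected U) (G : ℂ → X → ℂ)
    (hd : ∀ x, DifferentiableOn ℂ (fun s => G s x) U)
    (hb : ∀ K : Set X, IsCompact K → ∀ a ∈ U, ∃ M r : ℝ, 0 < r ∧ ∀ s ∈ ball a r, ∀ x ∈ K, ‖G s x‖ ≤ M)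
    {z₀ : ℂ} {ρ : ℝ} (hρ : 0 < ρ) (hball : ball z₀ ρ ⊆ U) (hcW : ∀ s ∈ ball z₀ ρ, Continuous (G s))
    {s : ℂ} (hs : s ∈ U) : Continuous (G s) := by
  refine continuous_iff_continuousAt.2 fun x₀ => ?_
  rw [ContinuousAt, tendsto_iff_seq_tendsto]
  intro u hu
  -- the sequence of holomorphic functions `F k = G · (u k)` and the expected limit `f = G · x₀`
  set F : ℕ → ℂ → ℂ := fun k z => G z (u k) with hF
  set f : ℂ → ℂ := fun z => G z x₀ with hf
  have hFd : ∀ k, DifferentiableOn ℂ (F k) U := fun k => hd (u k)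
  have hfd : DifferentiableOn ℂ f U := hd x₀
  -- local boundedness on `U`, from the compact set `{x₀} ∪ range u`
  have hcpt : IsCompact (insert x₀ (range u)) := hu.isCompact_insert_range
  have hbF : ∀ a ∈ U, ∃ M : ℝ, ∃ r > 0, ∀ k, ∀ z ∈ ball a r ∩ U, ‖F k z‖ ≤ M := by
    intro a ha
    obtain ⟨M, r, hr, hM⟩ := hb _ hcpt a ha
    exact ⟨M, r, hr, fun k z hz => hM z hz.1 (u k) (mem_insert_of_mem _ (mem_range_self k))⟩
  -- pointwise convergence on the ball in `W`
  have hpt : ∀ z ∈ ball z₀ ρ, Tendsto (fun k => F k z) atTop (𝓝 (f z)) := fun z hz =>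
    ((hcW z hz).tendsto x₀).comp hu
  have hz₀U : z₀ ∈ U := hball (mem_ball_self hρ)
  have hS : ∃ᶠ z in 𝓝[≠] z₀, ∃ c : ℂ, Tendsto (fun k => F k z) atTop (𝓝 c) := by
    have hev : ∀ᶠ z in 𝓝[≠] z₀, ∃ c : ℂ, Tendsto (fun k => F k z) atTop (𝓝 c) := by
      filter_upwards [mem_nhdsWithin_of_mem_nhds (ball_mem_nhds z₀ hρ)] with z hz
      exact ⟨f z, hpt z hz⟩
    exact hev.frequently
  obtain ⟨f', hf'd, hlim⟩ := Literature.Analysis.Complex.exists_tendstoLocallyUniformlyOn_of_frequently_tendsto hU hUc hFd hbF hz₀U hS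
  -- the locally uniform limit agrees with `f` on the ball, hence on `U`
  have hff' : EqOn f' f U := by
    refine (hf'd.analyticOnNhd hU).eqOn_of_preconnected_of_eventuallyEq (hfd.analyticOnNhd hU) hUc hz₀U ?_
    filter_upwards [ball_mem_nhds z₀ hρ] with z hz
    exact tendsto_nhds_unique (hlim.tendsto_at (hball hz)) (hpt z hz)
  have hconv : Tendsto (fun k => F k s) atTop (𝓝 (f' s)) := hlim.tendsto_at hs
  rw [hff' hs] at hconv
  exact hconv

/-- **HALF-PLANE FORM** (the shape of the (P,E⋆)-packages of Road Φ): `G : ℂ → X → ℂ` holomorphic on `{a < re}` in `s`, locally bounded on compacts of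
`X` near every point of `{a < re}`, and continuous in `x` for `c < re s` (`a ≤ c`; the convergence half-plane) ⟹ continuous in `x` for every `s` with
`a < re s`. [cite: CogdellAnalyticTheory2004, §2.3 p. 211] [cite: MoeglinWaldspurger1995, IV.1.9] -/
theorem continuous_of_differentiableOn_halfPlane {a c : ℝ} (hac : a ≤ c) (G : ℂ → X → ℂ)
    (hd : ∀ x, DifferentiableOn ℂ (fun s => G s x) {s : ℂ | a < s.re})
    (hb : ∀ K : Set X, IsCompact K → ∀ z : ℂ, a < z.re → ∃ M r : ℝ, 0 < r ∧ ∀ s ∈ ball z r, ∀ x ∈ K, ‖G s x‖ ≤ M)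
    (hcW : ∀ s : ℂ, c < s.re → Continuous (G s)) {s : ℂ} (hs : a < s.re) : Continuous (G s) := by
  have hU : IsOpen {s : ℂ | a < s.re} := isOpen_lt continuous_const Complex.continuous_re
  -- the ball `ball (c+1) 1 ⊆ {c < re} ⊆ {a < re}`
  set z₀ : ℂ := ((c + 1 : ℝ) : ℂ) with hz₀
  have hballc : ball z₀ 1 ⊆ {s : ℂ | c < s.re} := fun z hz => by
    have h1 : |z.re - z₀.re| ≤ dist z z₀ := by
      rw [Complex.dist_eq]
      simpa using Complex.abs_re_le_norm (z - z₀)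
    have h2 : dist z z₀ < 1 := mem_ball.1 hz
    have h3 := (abs_lt.1 (lt_of_le_of_lt h1 h2)).1
    have h4 : z₀.re = c + 1 := by rw [hz₀, Complex.ofReal_re]
    show c < z.re
    linarith
  have hballa : ball z₀ 1 ⊆ {s : ℂ | a < s.re} := fun z hz => lt_of_le_of_lt hac (hballc hz)
  exact continuous_of_differentiableOn_of_locallyBounded hU (convex_halfSpace_re_gt a).isPreconnected G hd
    (fun K hK z hz => hb K hK z hz) one_pos hballa (fun z hz => hcW z (hballc hz)) hs

end Summit.HodgeConjecture.HodgeConjecture.Cruxes.HLiu418.K2LiuContinuityFromHalfPlane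

end
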